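import Literature.NumberTheory.EllipticCurves.Hsieh2014.AnticyclotomicPAdicLFunctionAnyLevel
import Literature.NumberTheory.EllipticCurves.ModularityVersionApProofs
import Literature.NumberTheory.EllipticCurves.Rank1Residual.Predicates
import Summits.BirchSwinnertonDyer.Rank1Residual.X11b.LambdaSupplyPrime
import HarnessLib

set_option linter.dupNamespace false -- `Summit.BirchSwinnertonDyer.BirchSwinnertonDyer.Theorems.…` (summit = sub)
set_option autoImplicit false

/-!
# Crux `EisensteinHeartFlatCMInertBadKPrime` (stmt-BirchSwinnertonDyer-21341), line `hsieh-lambda`: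
# stub `stub_hsiehWitness` (existence of a Hsieh witness at every corner datum) — CONDITIONAL closer from the
# route's held print input Hsieh Doc. Math. 19 Thm A at any level

Route `BiquadraticEisensteinDescent` (cell `pub/bsd-wall`, lead-prover seat `bsd-wall-cm-bed-p1` g0, D-0152 M1).
Skeleton of record `hsieh-lambda` (sha `cec1b05af14b0698…`, tree
`Cruxes/EisensteinHeartFlatCMInertBadKPrime/Lines/hsieh_lambda.lean`): its first stub asks, at every datum
`(W, p ≥ 5 bad, K′ imaginary quadratic Heegner for N_W, κ anticyclotomic with generator γ, 𝔭 ∋ p, f a newform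
of W, ι′ compatible with 𝔭)`, for a HSIEH WITNESS `(A, Ω_K′, C, Ω_p ∈ R₀ˣ, Q_H)` with
`IsHsiehLFunction ι′ 𝔭 κ γ f A Ω_K′ C Ω_p Q_H`. This is the named fact
`Hsieh2014.thmA_exists_isHsiehLFunction_unrPeriod_anyLevel` (route support item `HsiehAnyLevelInput`,
stmt-BirchSwinnertonDyer-20456, binder h8 of `closes`) instantiated at the auxiliary character supplied by the
tree THEOREM `X11b.lambdaSupplyAt` (class field theory at every odd `p`): `p ∣ N_W` because `p` is bad
(`WeierstrassCurve.dvd_conductorNorm_iff_not_hasGoodReductionAtPrime`), so `p` splits in `K′` by the Heegner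
hypothesis, and `p ≠ 2`.

* `stub_hsiehWitness_of_thmA` — the registered stub signature VERBATIM with the named fact in front. A HELPER
  (conditional on Thm A; the stub itself is unconditional and closes only by formalising Thm A or by the pen
  threading `HsiehAnyLevelInput →` in front of the crux, as Thm B is threaded in front of the parent 20710).

THEOREMS ONLY (no definition, no named fact, no `sorry`); imports no `Theses` module; nothing about the crux or any
case of BSD is asserted. Supports, does not close, stmt-BirchSwinnertonDyer-21341.

References: [Hsieh2014] Thm. A / Thm. 1 (Doc. Math. 19 p. 712; arXiv:1112.1580 pp. 3–4) and Thm. 5.6 (p. 23);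
[Weil1956] §1–§2, [Greenberg1987] §2 (the λ-supply).
-/

noncomputable section

open scoped Classical NumberField

open NumberField IsDedekindDomain Field WeierstrassCurve
  Literature.NumberTheory.EllipticCurves Literature.NumberTheory.EllipticCurves.ModularForms
  Literature.NumberTheory.EllipticCurves.Rank1Residual
  Literature.NumberTheory.GaloisRepresentations
  Literature.NumberTheory.EllipticCurves.Hsieh2014
  Summit.BirchSwinnertonDyer.Rank1Residual.X11b

namespace Summit.BirchSwinnertonDyer.BirchSwinnertonDyer.Theorems.BiquadraticEisensteinDescentEisensteinHeartFlatCMInertBadKPrimeHsiehWitness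

/-- **Stub `stub_hsiehWitness` of line `hsieh-lambda`, GIVEN Hsieh's Thm A at any level.** For `W/ℚ` with a bad
prime `p ≥ 5`, `K′` imaginary quadratic satisfying the Heegner hypothesis for `N_W`, an anticyclotomic
`ℤ_p`-extension `κ` with topological generator `γ`, a prime `𝔭 ∋ p` of `K′`, a newform `f` of `W` and
`ι′ : ℚ̄_p ≃ ℂ` compatible with `𝔭`, there is a Hsieh witness `(A, Ω_K′, C, Ω_p, Q_H)` (`0 < A`, `Ω_K′ ≠ 0`,
`‖ι′⁻¹C‖ = 1`, `Ω_p ∈ R₀ˣ`, `IsHsiehLFunction ι′ 𝔭 κ γ f A Ω_K′ C Ω_p Q_H`). Proof: `p ∣ N_W` (bad prime), hence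
`p` splits in `K′` (Heegner); λ-supply `lambdaSupplyAt`; apply the named fact.
[cite: Hsieh2014, Thm. A p. 712 (Doc. Math. 19) = Thm. 1 (arXiv:1112.1580 pp. 3–4)] -/
theorem stub_hsiehWitness_of_thmA (hA : thmA_exists_isHsiehLFunction_unrPeriod_anyLevel) :
    ∀ (W : WeierstrassCurve ℚ) [W.IsElliptic] [W.IsGloballyMinimal] (p : ℕ) [Fact p.Prime]
      [NeZero (W.conductorNorm ℤ)] (K : Type) [Field K] [NumberField K],
      5 ≤ p → ¬ Good W p → IsImaginaryQuadratic K → SatisfiesHeegnerHypothesis (W.conductorNorm ℤ) K →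
      ∀ (κ : ZpExtension K p), κ.IsAnticyclotomic →
        ∀ (γ : Field.absoluteGaloisGroup K) [Fact (κ.IsTopGenerator γ)]
          (𝔭 : HeightOneSpectrum (𝓞 K)), ((p : ℕ) : 𝓞 K) ∈ 𝔭.asIdeal →
          ∀ (f : CuspForm (CongruenceSubgroup.Gamma0 (W.conductorNorm ℤ)) 2), IsNewformOf W f →
            ∀ (ι' : PadicAlgCl p ≃+* ℂ),
              (∀ (w : InfinitePlace K) (k : 𝓞 K), k ∈ 𝔭.asIdeal ↔ ‖ι'.symm (w.embedding (k : K))‖ < 1) →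
              ∃ (A : ℝ) (ΩK C : ℂ) (Ωp : (unrIntegers p)ˣ) (QH : PowerSeries (PadicComplexInt p)),
                0 < A ∧ ΩK ≠ 0 ∧ ‖((ι'.symm C : PadicAlgCl p) : ℂ_[p])‖ = 1 ∧
                  IsHsiehLFunction ι' 𝔭 κ γ f A ΩK C ((Ωp : unrIntegers p) : ℂ_[p]) QH := by
  intro W _ _ p _ _ K _ _ hp5 hbad hK hHN κ hκ γ hγ 𝔭 h𝔭 f hf ι' hι
  have hp : p.Prime := Fact.out
  have hp2 : p ≠ 2 := by omega
  have hpN : p ∣ W.conductorNorm ℤ := (W.dvd_conductorNorm_iff_not_hasGoodReductionAtPrime p).mpr hbad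
  have hsplit : ((Ideal.span {(p : ℤ)}).primesOver (𝓞 K)).ncard = 2 := hHN p hp hpN
  obtain ⟨lam, rlam, hunit, hinfl, hAQ, hunrl, havl, hfacl⟩ := lambdaSupplyAt hp2 ι' K κ hK hκ
  exact hA ι' K 𝔭 κ γ f lam rlam hp2 hf.1 hK hsplit h𝔭 hι hHN hunit hinfl hAQ hunrl havl hfacl hκ hγ.out

end Summit.BirchSwinnertonDyer.BirchSwinnertonDyer.Theorems.BiquadraticEisensteinDescentEisensteinHeartFlatCMInertBadKPrimeHsiehWitness

end
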